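/-
Copyright (c) 2026 the pub-hodgecm-mathlib formalisation cell (harness21).  Prover seat hodgecm-mathlib-K2E1-p09 (g6), Track B ∕ K2-LIT, h413 =
`stmt-HodgeConjecture-24833`, ENGINE E1, campaign «EIS-WHITTAKER-3», deal D-W5 «W2₃-fin-S» of the dealer K2E1-plan (g5) (DEALS MEMO
`K2/K2E1-plan/g5/DEALS-EIS-WHITTAKER-3-wave1.K2E1-plan-g5.md` fe56b7cd5d935977 §D-W5, RE-KEY 2026-09-04T08:09:42Z; REPORT-FIRST heads on the K2 bus 08:40:13Z).
-/
import Summits.HodgeConjecture.HodgeConjecture.Theorems.K2E1FiniteWhittakerStepSymbol   -- ★ p858371 (K2E4-p14 g6): the N = 2 engine; `setIntegral_ball_addChar_eq_ite`, `iUnion_ball_sub_nat`; brings ★ Tate local files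
import HarnessLib

/-!
# K2·E1 — `K2E1FiniteWhittakerStepSymbolU3` (D-W5 «W2₃-fin-S», FILE A): THE FINITE WHITTAKER `S`-FACTOR ENGINE OF `U(2,1)` — RADIAL STEP KERNELS WITH COMPLEX SHELL
# VALUES, THE FINITE SHELL SUM, THE THRESHOLD, THE TRIVIAL BOUND, TAIL CANCELLATION, PARAMETRIC HOLOMORPHY

Track B ∕ K2-LIT, crux h413 = `stmt-HodgeConjecture-24833`, route of record `HCCMUnconditional`; cell `hodgecm-mathlib`, squad K2, ENGINE E1 (campaign «EIS-WHITTAKER-3», spec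
of record = K2E1b-plan (g6) CENSUS `CENSUS-EIS-WHITTAKER-3.K2E1b-plan-g6.md` ba907189b20ed180 §2 «Bad places `v ∈ S_ξ`», W0₃ CONVENTIONS 2fdd2f7063acaab9 §4 (iii)).  Deal D-W5
of K2E1-plan (g5); prover seat `hodgecm-mathlib-K2E1-p09` (g6).  THEOREMS ONLY (no `def`, no `instance`, no notation, no named-fact hypothesis, no `sorry`; default heartbeats);
lane `--supports stmt-HodgeConjecture-24833 --as helper` (count-neutral).  Closes no socket.  CURRENCY = ★ p858371's: a non-archimedean local field `K` (`= L_w`), `𝔭^j =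
primePowBall K j`, any additive Haar measure `μ`, a continuous `ψ : AddChar K Circle` of conductor exponent `m`, Tate's character `ψ(X·ξ)`; for the two-variable kernels ANY measure
space `(T, ν)` (`= (L⁺_v, ν_v)`, the centre variable).

THE MATHEMATICS [Tate1950, §2.5; JacquetLanglands1970, §3; Casselman1980, §3].  At a finite place `v ∈ S` of `L⁺` (ramified, dyadic, `δ` a non-unit, or `ψ` ramified) the
abelian Whittaker local factor of the spherical section of `U(2,1)_{L∕L⁺}` is (W0₃ §1 (W), §3)
  `W_v(ξ, z) = ∫_{L_w} Ψ_z(X) ψ_w(Xξ) dX`,   `Ψ_z(X) := ∫_{L⁺_v} h_v(X, t)^{−z} dt`,   `h_v(X,t) = ∏_{w∣v} max(1, ‖X_w‖, ‖(tδ − ½X·cX)_w‖) ≥ 1`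
(★ (a2)₃ `K2E1HeightBigCellLineFormulaU3` :321).  Unlike N = 2 (★ p858371, kernel `P(t)^{−z}`) the `X`-kernel `Ψ_z` is NOT a power of a step function: it is a RADIAL STEP
KERNEL WITH COMPLEX SHELL VALUES — `Ψ_z = c₀(z)` on a base ball `𝔭^a` and `Ψ_z = c_k(z)` on the shell `𝔭^{a−k−1} ∖ 𝔭^{a−k}` — whose values `c_k(z)` are `t`-integrals, each
holomorphic only on `Re z > ½` (the `t`-tail `Σ_j q^{j(1−2z)}` has poles on `Re z = ½`).  This file is the N = 3 engine:
§1–§2 (Tate's computation with complex shell values; `J_j := ∫_{𝔭^j} ψ(Xξ) dμ = 𝟙[ξ ∈ 𝔭^{m−j}]·μ(𝔭^j)`): a radial step kernel is CONTINUOUS (shells and the base ball are clopen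
and cover `K`); THE BALL FORMULA `∫_{𝔭^{a−K}} Ψ ψ(Xξ) = c₀ J_a + Σ_{k<K} c_k (J_{a−k−1} − J_{a−k})`; for `ξ ∈ 𝔭^{m−a+n} ∖ 𝔭^{m−a+n+1}` and `K > n` the ball integrals equal the
FINITE SHELL SUM **`S(c₀, c; n) := c₀ μ(𝔭^a) + Σ_{k<n} c_k (μ(𝔭^{a−k−1}) − μ(𝔭^{a−k})) − c_n μ(𝔭^{a−n})`**, for `ξ ∉ 𝔭^{m−a}` (below the conductor-shifted THRESHOLD) every
ball integral VANISHES, and the whole-`K` integral (for an integrable integrand) is `S` resp. `0`.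
§3 (the N = 3 novelty) **TAIL CANCELLATION**: the coefficients of `S` sum to zero, `μ(𝔭^a) + Σ_{k<n}(μ(𝔭^{a−k−1}) − μ(𝔭^{a−k})) − μ(𝔭^{a−n}) = 0`, hence `S(c₀ + g, c + g; n) =
S(c₀, c; n)` for any common summand `g` — so a common `t`-TAIL of the shell values drops out; bounds: `‖S‖ ≤ Σ ‖c_k‖·(measures)`, LINEAR IN `n` under a decay letter
`‖c_k‖·μ(𝔭^{a−k−1}) ≤ B` (the divisor-type growth W-hWbd₃ multiplies over `S_ξ`), and the TRIVIAL BOUND `‖∫ Ψ ψ(Xξ)‖ ≤ ∫ ‖Ψ‖` (`|ψ| = 1`: the untwisted integral at `σ = Re z`,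
uniform in `ξ` — the W4₃ majorant on compacta of `{1 < Re z}`).
§4 PARAMETRIC HOLOMORPHY: holomorphic shell values (for `k ≤ n`) give a holomorphic shell sum, and an integral that agrees with it on a set is holomorphic there.
THE TWO-VARIABLE KERNELS `Ψ_z(X) = ∫_T h(X,t)^{−z} dν` (entire bounded-`t` integrals, the tail split, the HEAD «the `S`-factor is ONE ENTIRE FUNCTION although no single shell
value is») are the sibling FILE `K2E1FiniteWhittakerStepSymbolU3Tail` (400-line law); the INSTANCE at ★ (a2)₃'s bad-place local factor is `K2E1FiniteWhittakerStepSymbolU3Line`.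
CURRENCY-FREE ON PURPOSE: the transport of ★ (a2)₃'s local factor at a bad place to coordinates is in no file ((q10) FILE 2(b) is unramified-only).

* §1 `continuous_of_radialStep`, `integrableOn_radialStep_mul_addChar`, `setIntegral_ball_succ_radialStep_mul_addChar`, **`setIntegral_ball_radialStep_mul_addChar_eq_sum`**.
* §2 **`setIntegral_ball_radialStep_mul_addChar_eq_shellSum`**, **`setIntegral_ball_radialStep_mul_addChar_eq_zero_of_not_mem`**, `tendsto_setIntegral_ball_mul_addChar`,
  **`integral_radialStep_mul_addChar_eq_shellSum`**, **`integral_radialStep_mul_addChar_eq_zero_of_not_mem`**, `integrable_mul_addChar_of_integrable`.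
* §3 **`shellSum_add_const`** (tail cancellation), `norm_shellSum_le`, **`norm_shellSum_le_linear`**, **`norm_integral_mul_addChar_le`** (trivial bound).
* §4 `differentiableOn_shellSum`, `differentiable_shellSum`, **`differentiableOn_integral_of_eq_shellSum`**.
HONEST LABEL: HC_CM is proved only modulo the 7 printed citations (2 remaining named inputs: hLiu418 = `stmt-HodgeConjecture-24832`, h413 = `stmt-HodgeConjecture-24833`) until rung 0
closes; this file asserts no named fact and closes no socket; count-neutral.

## References
* [Tate1950] J. Tate, *Fourier analysis in number fields and Hecke's zeta-functions* (1950), §2.5, in Cassels–Fröhlich (1967) Ch. XV.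
* [JacquetLanglands1970] H. Jacquet, R. P. Langlands, *Automorphic Forms on GL(2)*, LNM 114 (1970), §3 (Whittaker functions at ramified places are finite shell sums).
* [Casselman1980] W. Casselman, *The unramified principal series of p-adic groups I*, Compositio Math. 40 (1980), §3.
-/

set_option autoImplicit false
set_option linter.dupNamespace false  -- the mandated namespace repeats the summit's segment (`HodgeConjecture.HodgeConjecture`)

noncomputable section

open MeasureTheory Filter Topology Set
open scoped NNReal ENNReal
open Literature.NumberTheory.GaloisRepresentations.IsNonarchimedeanLocalField
open Literature.NumberTheory.Automorphic Literature.NumberTheory.Automorphic.LocalFieldHaar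
open Summit.HodgeConjecture.HodgeConjecture.Cruxes.H413.K2E1FiniteWhittakerStepSymbol (setIntegral_ball_addChar_eq_ite iUnion_ball_sub_nat)

namespace Summit.HodgeConjecture.HodgeConjecture.Cruxes.H413.K2E1FiniteWhittakerStepSymbolU3

variable {K : Type*} [Field K] [ValuativeRel K] [TopologicalSpace K] [IsNonarchimedeanLocalField K]

/-! ## §1 Radial step kernels with complex shell values: continuity, ball integrability, one shell, the ball formula -/

/-- **A RADIAL STEP KERNEL IS CONTINUOUS**: if `Ψ = c₀` on the base ball `𝔭^a` and `Ψ = c_k` on each shell `𝔭^{a−k−1} ∖ 𝔭^{a−k}`, then `Ψ` is locally constant — the base ball is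
open and the shells are open (`𝔭^j` is clopen), and together they cover `K` (`⋃_K 𝔭^{a−K} = K`, ★ `iUnion_ball_sub_nat`). [folklore] -/
theorem continuous_of_radialStep {Ψ : K → ℂ} {a : ℤ} {c₀ : ℂ} (h0 : ∀ X ∈ primePowBall K a, Ψ X = c₀) {c : ℕ → ℂ}
    (hc : ∀ k : ℕ, ∀ X ∈ primePowBall K (a - ((k : ℤ) + 1)) \ primePowBall K (a - (k : ℤ)), Ψ X = c k) : Continuous Ψ := by
  classical
  refine continuous_iff_continuousAt.2 fun X => ?_
  by_cases hX : X ∈ primePowBall K a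
  · exact (continuousAt_const (y := c₀)).congr (Filter.eventuallyEq_of_mem ((isOpen_primePowBall a).mem_nhds hX) fun Y hY => (h0 Y hY).symm)
  · have hex : ∃ n : ℕ, X ∈ primePowBall K (a - (n : ℤ)) := by
      have hXu : X ∈ ⋃ n : ℕ, primePowBall K (a - (n : ℤ)) := by rw [iUnion_ball_sub_nat]; exact Set.mem_univ X
      exact Set.mem_iUnion.1 hXu
    have hN := Nat.find_spec hex
    have hN0 : Nat.find hex ≠ 0 := by
      intro h0'
      rw [h0', Nat.cast_zero, sub_zero] at hN
      exact hX hN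
    obtain ⟨k, hk⟩ : ∃ k, Nat.find hex = k + 1 := Nat.exists_eq_succ_of_ne_zero hN0
    have hXin : X ∈ primePowBall K (a - ((k : ℤ) + 1)) := by
      have h := hN
      rw [hk, Nat.cast_succ] at h
      exact h
    have hXout : X ∉ primePowBall K (a - (k : ℤ)) := fun h => by
      have hmin := Nat.find_min hex (show k < Nat.find hex by omega)
      exact hmin h
    have hopen : IsOpen (primePowBall K (a - ((k : ℤ) + 1)) \ primePowBall K (a - (k : ℤ))) := (isOpen_primePowBall _).sdiff (isClosed_primePowBall _)
    exact (continuousAt_const (y := c k)).congr (Filter.eventuallyEq_of_mem (hopen.mem_nhds ⟨hXin, hXout⟩) fun Y hY => (hc k Y hY).symm)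

variable [MeasurableSpace K] [BorelSpace K] (μ : Measure K) [μ.IsAddHaarMeasure]

/-- The integrand `Ψ(X)·ψ(Xξ)` of a radial step kernel is integrable on every ball (continuous on a compact set). [folklore] -/
theorem integrableOn_radialStep_mul_addChar {Ψ : K → ℂ} {a : ℤ} {c₀ : ℂ} (h0 : ∀ X ∈ primePowBall K a, Ψ X = c₀) {c : ℕ → ℂ}
    (hc : ∀ k : ℕ, ∀ X ∈ primePowBall K (a - ((k : ℤ) + 1)) \ primePowBall K (a - (k : ℤ)), Ψ X = c k) {ψ : AddChar K Circle} (hψ : Continuous ψ) (ξ : K) (j : ℤ) :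
    IntegrableOn (fun X : K => Ψ X * ((ψ (X * ξ) : Circle) : ℂ)) (primePowBall K j) μ := by
  haveI : T2Space K := (Literature.NumberTheory.GaloisRepresentations.IsNonarchimedeanLocalField.isLocalField K).toT2Space
  exact (((continuous_of_radialStep h0 hc).mul (continuous_subtype_val.comp (hψ.comp (continuous_id.mul continuous_const)))).continuousOn.integrableOn_compact
    (isCompact_primePowBall j))

/-- **One shell**: on `𝔭^{a−k−1} ∖ 𝔭^{a−k}` the kernel is the constant `c_k`, so `∫_{𝔭^{a−k−1}} Ψ ψ = ∫_{𝔭^{a−k}} Ψ ψ + c_k·(∫_{𝔭^{a−k−1}} ψ − ∫_{𝔭^{a−k}} ψ)`. [cite: Tate1950, §2.5] -/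
theorem setIntegral_ball_succ_radialStep_mul_addChar {Ψ : K → ℂ} {a : ℤ} {c₀ : ℂ} (h0 : ∀ X ∈ primePowBall K a, Ψ X = c₀) {c : ℕ → ℂ}
    (hc : ∀ k : ℕ, ∀ X ∈ primePowBall K (a - ((k : ℤ) + 1)) \ primePowBall K (a - (k : ℤ)), Ψ X = c k) {ψ : AddChar K Circle} (hψ : Continuous ψ) (ξ : K) (k : ℕ) :
    ∫ X in primePowBall K (a - ((k : ℤ) + 1)), Ψ X * ((ψ (X * ξ) : Circle) : ℂ) ∂μ =
      (∫ X in primePowBall K (a - (k : ℤ)), Ψ X * ((ψ (X * ξ) : Circle) : ℂ) ∂μ) +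
        c k * ((∫ X in primePowBall K (a - ((k : ℤ) + 1)), ((ψ (X * ξ) : Circle) : ℂ) ∂μ) - ∫ X in primePowBall K (a - (k : ℤ)), ((ψ (X * ξ) : Circle) : ℂ) ∂μ) := by
  have hsub : primePowBall K (a - (k : ℤ)) ⊆ primePowBall K (a - ((k : ℤ) + 1)) := primePowBall_antitone (by omega)
  have hsplit : ∀ (g : K → ℂ), IntegrableOn g (primePowBall K (a - ((k : ℤ) + 1))) μ →
      ∫ X in primePowBall K (a - ((k : ℤ) + 1)), g X ∂μ =
        (∫ X in primePowBall K (a - (k : ℤ)), g X ∂μ) + ∫ X in primePowBall K (a - ((k : ℤ) + 1)) \ primePowBall K (a - (k : ℤ)), g X ∂μ := by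
    intro g hg
    rw [setIntegral_sdiff (measurableSet_primePowBall _) hg hsub]
    ring
  rw [hsplit _ (integrableOn_radialStep_mul_addChar μ h0 hc hψ ξ _)]
  congr 1
  have hconst : ∀ X ∈ primePowBall K (a - ((k : ℤ) + 1)) \ primePowBall K (a - (k : ℤ)),
      Ψ X * ((ψ (X * ξ) : Circle) : ℂ) = c k * ((ψ (X * ξ) : Circle) : ℂ) := fun X hX => by rw [hc k X hX]
  rw [setIntegral_congr_fun ((measurableSet_primePowBall _).diff (measurableSet_primePowBall _)) hconst, integral_const_mul,
    setIntegral_sdiff (measurableSet_primePowBall _) (K2E1FiniteWhittakerPolynomial.integrableOn_addChar μ hψ ξ _) hsub]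

/-- **THE BALL FORMULA**: `∫_{𝔭^{a−K}} Ψ(X) ψ(Xξ) dμ = c₀·J_a + Σ_{k<K} c_k·(J_{a−k−1} − J_{a−k})`, `J_j = ∫_{𝔭^j} ψ(Xξ) dμ` (`Ψ = c₀` on `𝔭^a`, then shell by shell).
[cite: Tate1950, §2.5] [cite: Casselman1980, §3] -/
theorem setIntegral_ball_radialStep_mul_addChar_eq_sum {Ψ : K → ℂ} {a : ℤ} {c₀ : ℂ} (h0 : ∀ X ∈ primePowBall K a, Ψ X = c₀) {c : ℕ → ℂ}
    (hc : ∀ k : ℕ, ∀ X ∈ primePowBall K (a - ((k : ℤ) + 1)) \ primePowBall K (a - (k : ℤ)), Ψ X = c k) {ψ : AddChar K Circle} (hψ : Continuous ψ) (ξ : K) (N : ℕ) :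
    ∫ X in primePowBall K (a - (N : ℤ)), Ψ X * ((ψ (X * ξ) : Circle) : ℂ) ∂μ =
      c₀ * (∫ X in primePowBall K a, ((ψ (X * ξ) : Circle) : ℂ) ∂μ) +
        ∑ k ∈ Finset.range N, c k *
          ((∫ X in primePowBall K (a - ((k : ℤ) + 1)), ((ψ (X * ξ) : Circle) : ℂ) ∂μ) - ∫ X in primePowBall K (a - (k : ℤ)), ((ψ (X * ξ) : Circle) : ℂ) ∂μ) := by
  induction N with
  | zero =>
    rw [Finset.sum_range_zero, add_zero, Nat.cast_zero, sub_zero, ← integral_const_mul]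
    exact setIntegral_congr_fun (measurableSet_primePowBall a) fun X hX => by rw [h0 X hX]
  | succ N ih =>
    rw [Nat.cast_succ, setIntegral_ball_succ_radialStep_mul_addChar μ h0 hc hψ ξ N, ih, Finset.sum_range_succ]
    ring

/-! ## §2 The finite shell sum on large balls, the threshold, and the whole-`K` integral -/

/-- **THE SHELL SUM ON LARGE BALLS**: if `ξ ∈ 𝔭^{m−a+n} ∖ 𝔭^{m−a+n+1}` (`n = ord ξ − m + a ≥ 0`) then for every `K > n`
`∫_{𝔭^{a−K}} Ψ(X) ψ(Xξ) dμ = S(c₀, c; n) := c₀ μ(𝔭^a) + Σ_{k<n} c_k (μ(𝔭^{a−k−1}) − μ(𝔭^{a−k})) − c_n μ(𝔭^{a−n})` — independent of `K`: a FINITE shell sum with complex shell values.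
[cite: Tate1950, §2.5] [cite: JacquetLanglands1970, §3] -/
theorem setIntegral_ball_radialStep_mul_addChar_eq_shellSum {Ψ : K → ℂ} {a : ℤ} {c₀ : ℂ} (h0 : ∀ X ∈ primePowBall K a, Ψ X = c₀) {c : ℕ → ℂ}
    (hc : ∀ k : ℕ, ∀ X ∈ primePowBall K (a - ((k : ℤ) + 1)) \ primePowBall K (a - (k : ℤ)), Ψ X = c k) {ψ : AddChar K Circle} (hψ : Continuous ψ) {m : ℤ}
    (hm : ψ.HasConductorExp m) {ξ : K} {n : ℕ} (hn : ξ ∈ primePowBall K (m - a + n)) (hn' : ξ ∉ primePowBall K (m - a + n + 1)) {N : ℕ} (hN : n < N) :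
    ∫ X in primePowBall K (a - (N : ℤ)), Ψ X * ((ψ (X * ξ) : Circle) : ℂ) ∂μ =
      c₀ * (μ.real (primePowBall K a) : ℂ) +
        (∑ k ∈ Finset.range n, c k * ((μ.real (primePowBall K (a - ((k : ℤ) + 1))) : ℂ) - (μ.real (primePowBall K (a - (k : ℤ))) : ℂ))) -
        c n * (μ.real (primePowBall K (a - (n : ℤ))) : ℂ) := by
  have hJ := setIntegral_ball_addChar_eq_ite μ hm hn hn'
  have hterm0 : ∀ k, n < k →
      c k * ((∫ X in primePowBall K (a - ((k : ℤ) + 1)), ((ψ (X * ξ) : Circle) : ℂ) ∂μ) - ∫ X in primePowBall K (a - (k : ℤ)), ((ψ (X * ξ) : Circle) : ℂ) ∂μ) = 0 := by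
    intro k hk
    have h1 := hJ (k + 1)
    rw [Nat.cast_succ] at h1
    rw [h1, hJ k, if_neg (by omega), if_neg (by omega), sub_zero, mul_zero]
  have hstab : ∀ j : ℕ, ∑ k ∈ Finset.range (n + 1 + j), c k *
      ((∫ X in primePowBall K (a - ((k : ℤ) + 1)), ((ψ (X * ξ) : Circle) : ℂ) ∂μ) - ∫ X in primePowBall K (a - (k : ℤ)), ((ψ (X * ξ) : Circle) : ℂ) ∂μ) =
      ∑ k ∈ Finset.range (n + 1), c k *
        ((∫ X in primePowBall K (a - ((k : ℤ) + 1)), ((ψ (X * ξ) : Circle) : ℂ) ∂μ) - ∫ X in primePowBall K (a - (k : ℤ)), ((ψ (X * ξ) : Circle) : ℂ) ∂μ) := by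
    intro j
    induction j with
    | zero => rw [add_zero]
    | succ j ih => rw [← add_assoc, Finset.sum_range_succ, ih, hterm0 _ (by omega), add_zero]
  obtain ⟨j, rfl⟩ : ∃ j, N = n + 1 + j := ⟨N - (n + 1), by omega⟩
  rw [setIntegral_ball_radialStep_mul_addChar_eq_sum μ h0 hc hψ ξ, hstab j, Finset.sum_range_succ]
  have hJ0 : ∫ X in primePowBall K a, ((ψ (X * ξ) : Circle) : ℂ) ∂μ = (μ.real (primePowBall K a) : ℂ) := by
    have h := hJ 0
    rw [Nat.cast_zero, sub_zero] at h
    rw [h, if_pos (Nat.zero_le n)]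
  have hmid : ∑ k ∈ Finset.range n, c k *
      ((∫ X in primePowBall K (a - ((k : ℤ) + 1)), ((ψ (X * ξ) : Circle) : ℂ) ∂μ) - ∫ X in primePowBall K (a - (k : ℤ)), ((ψ (X * ξ) : Circle) : ℂ) ∂μ) =
      ∑ k ∈ Finset.range n, c k * ((μ.real (primePowBall K (a - ((k : ℤ) + 1))) : ℂ) - (μ.real (primePowBall K (a - (k : ℤ))) : ℂ)) := by
    refine Finset.sum_congr rfl fun k hk => ?_
    have hk' : k < n := Finset.mem_range.1 hk
    have h1 := hJ (k + 1)
    rw [Nat.cast_succ] at h1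
    rw [h1, hJ k, if_pos (by omega), if_pos hk'.le]
  have hlast : c n * ((∫ X in primePowBall K (a - ((n : ℤ) + 1)), ((ψ (X * ξ) : Circle) : ℂ) ∂μ) - ∫ X in primePowBall K (a - (n : ℤ)), ((ψ (X * ξ) : Circle) : ℂ) ∂μ) =
      -(c n * (μ.real (primePowBall K (a - (n : ℤ))) : ℂ)) := by
    have h1 := hJ (n + 1)
    rw [Nat.cast_succ] at h1
    rw [h1, hJ n, if_neg (by omega), if_pos le_rfl, zero_sub, mul_neg]
  rw [hJ0, hmid, hlast]
  ring

/-- **VANISHING BELOW THE THRESHOLD**: if `ξ ∉ 𝔭^{m−a}` (`ord ξ < m − a`) every `J_{a−k} = 0`, so `∫_{𝔭^{a−K}} Ψ(X) ψ(Xξ) dμ = 0` for every `K`. [cite: Tate1950, §2.5] -/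
theorem setIntegral_ball_radialStep_mul_addChar_eq_zero_of_not_mem {Ψ : K → ℂ} {a : ℤ} {c₀ : ℂ} (h0 : ∀ X ∈ primePowBall K a, Ψ X = c₀) {c : ℕ → ℂ}
    (hc : ∀ k : ℕ, ∀ X ∈ primePowBall K (a - ((k : ℤ) + 1)) \ primePowBall K (a - (k : ℤ)), Ψ X = c k) {ψ : AddChar K Circle} (hψ : Continuous ψ) {m : ℤ}
    (hm : ψ.HasConductorExp m) {ξ : K} (hξ : ξ ∉ primePowBall K (m - a)) (N : ℕ) :
    ∫ X in primePowBall K (a - (N : ℤ)), Ψ X * ((ψ (X * ξ) : Circle) : ℂ) ∂μ = 0 := by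
  have hJ : ∀ k : ℕ, ∫ X in primePowBall K (a - (k : ℤ)), ((ψ (X * ξ) : Circle) : ℂ) ∂μ = 0 := fun k => by
    rw [setIntegral_primePowBall_addChar_mul μ hm (a - (k : ℤ)) ξ, show m - (a - (k : ℤ)) = m - a + (k : ℤ) by ring,
      if_neg (fun h : ξ ∈ primePowBall K (m - a + (k : ℤ)) => hξ (primePowBall_antitone (show m - a ≤ m - a + (k : ℤ) by omega) h))]
  rw [setIntegral_ball_radialStep_mul_addChar_eq_sum μ h0 hc hψ ξ N]
  have hJ0 := hJ 0
  rw [Nat.cast_zero, sub_zero] at hJ0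
  rw [hJ0, mul_zero, zero_add]
  refine Finset.sum_eq_zero fun k _ => ?_
  have h1 := hJ (k + 1)
  rw [Nat.cast_succ] at h1
  rw [h1, hJ k, sub_zero, mul_zero]

omit [μ.IsAddHaarMeasure] in
/-- The whole-`K` integral is the limit of the ball integrals along `𝔭^{a−K}` (for an integrand integrable on `K`). [folklore] -/
theorem tendsto_setIntegral_ball_mul_addChar {Ψ : K → ℂ} {ψ : AddChar K Circle} (ξ : K) (a : ℤ)
    (hint : Integrable (fun X : K => Ψ X * ((ψ (X * ξ) : Circle) : ℂ)) μ) :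
    Tendsto (fun N : ℕ => ∫ X in primePowBall K (a - (N : ℤ)), Ψ X * ((ψ (X * ξ) : Circle) : ℂ) ∂μ) atTop (𝓝 (∫ X, Ψ X * ((ψ (X * ξ) : Circle) : ℂ) ∂μ)) := by
  have hmono : Monotone fun N : ℕ => primePowBall K (a - (N : ℤ)) := fun b b' hbb' => primePowBall_antitone (by omega)
  have h := tendsto_setIntegral_of_monotone (μ := μ) (f := fun X : K => Ψ X * ((ψ (X * ξ) : Circle) : ℂ))
    (fun N : ℕ => measurableSet_primePowBall (a - (N : ℤ))) hmono (by rw [iUnion_ball_sub_nat]; exact hint.integrableOn)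
  rwa [iUnion_ball_sub_nat, setIntegral_univ] at h

/-- **THE WHOLE-`K` INTEGRAL IS THE SHELL SUM** — for a radial step kernel `Ψ` (`= c₀` on `𝔭^a`, `= c_k` on the shells), `ψ` continuous of conductor exponent `m`,
`ξ ∈ 𝔭^{m−a+n} ∖ 𝔭^{m−a+n+1}` and an integrand integrable on `K`:  `∫_K Ψ(X) ψ(Xξ) dμ = c₀ μ(𝔭^a) + Σ_{k<n} c_k (μ(𝔭^{a−k−1}) − μ(𝔭^{a−k})) − c_n μ(𝔭^{a−n})`.
[cite: Tate1950, §2.5] [cite: JacquetLanglands1970, §3] -/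
theorem integral_radialStep_mul_addChar_eq_shellSum {Ψ : K → ℂ} {a : ℤ} {c₀ : ℂ} (h0 : ∀ X ∈ primePowBall K a, Ψ X = c₀) {c : ℕ → ℂ}
    (hc : ∀ k : ℕ, ∀ X ∈ primePowBall K (a - ((k : ℤ) + 1)) \ primePowBall K (a - (k : ℤ)), Ψ X = c k) {ψ : AddChar K Circle} (hψ : Continuous ψ) {m : ℤ}
    (hm : ψ.HasConductorExp m) {ξ : K} {n : ℕ} (hn : ξ ∈ primePowBall K (m - a + n)) (hn' : ξ ∉ primePowBall K (m - a + n + 1))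
    (hint : Integrable (fun X : K => Ψ X * ((ψ (X * ξ) : Circle) : ℂ)) μ) :
    ∫ X, Ψ X * ((ψ (X * ξ) : Circle) : ℂ) ∂μ =
      c₀ * (μ.real (primePowBall K a) : ℂ) +
        (∑ k ∈ Finset.range n, c k * ((μ.real (primePowBall K (a - ((k : ℤ) + 1))) : ℂ) - (μ.real (primePowBall K (a - (k : ℤ))) : ℂ))) -
        c n * (μ.real (primePowBall K (a - (n : ℤ))) : ℂ) := by
  refine tendsto_nhds_unique (tendsto_setIntegral_ball_mul_addChar μ ξ a hint) (tendsto_const_nhds.congr' ?_)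
  filter_upwards [Filter.eventually_gt_atTop n] with N hN
  exact (setIntegral_ball_radialStep_mul_addChar_eq_shellSum μ h0 hc hψ hm hn hn' hN).symm

/-- **VANISHING OF THE WHOLE-`K` INTEGRAL BELOW THE THRESHOLD** (the SUPPORT of the `S`-factor in the frequency): if `ξ ∉ 𝔭^{m−a}` then `∫_K Ψ(X) ψ(Xξ) dμ = 0` (integrand
integrable on `K`). [cite: Tate1950, §2.5] -/
theorem integral_radialStep_mul_addChar_eq_zero_of_not_mem {Ψ : K → ℂ} {a : ℤ} {c₀ : ℂ} (h0 : ∀ X ∈ primePowBall K a, Ψ X = c₀) {c : ℕ → ℂ}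
    (hc : ∀ k : ℕ, ∀ X ∈ primePowBall K (a - ((k : ℤ) + 1)) \ primePowBall K (a - (k : ℤ)), Ψ X = c k) {ψ : AddChar K Circle} (hψ : Continuous ψ) {m : ℤ}
    (hm : ψ.HasConductorExp m) {ξ : K} (hξ : ξ ∉ primePowBall K (m - a)) (hint : Integrable (fun X : K => Ψ X * ((ψ (X * ξ) : Circle) : ℂ)) μ) :
    ∫ X, Ψ X * ((ψ (X * ξ) : Circle) : ℂ) ∂μ = 0 :=
  tendsto_nhds_unique (tendsto_setIntegral_ball_mul_addChar μ ξ a hint)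
    (tendsto_const_nhds.congr' (Eventually.of_forall fun N => (setIntegral_ball_radialStep_mul_addChar_eq_zero_of_not_mem μ h0 hc hψ hm hξ N).symm))

omit [μ.IsAddHaarMeasure] in
/-- The integrability letter reduces to that of the kernel: `Ψ ∈ L¹(μ)` and `ψ` continuous ⟹ `Ψ·ψ(·ξ) ∈ L¹(μ)` (`|ψ| = 1`). [folklore] -/
theorem integrable_mul_addChar_of_integrable {Ψ : K → ℂ} (hΨ : Integrable Ψ μ) {ψ : AddChar K Circle} (hψ : Continuous ψ) (ξ : K) :
    Integrable (fun X : K => Ψ X * ((ψ (X * ξ) : Circle) : ℂ)) μ := by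
  exact hΨ.mul_bdd (c := 1) (continuous_subtype_val.comp (hψ.comp (continuous_id.mul continuous_const))).aestronglyMeasurable
    (Eventually.of_forall fun X => by rw [Circle.norm_coe])

/-! ## §3 Tail cancellation, the shell-sum bounds, the trivial bound -/

omit [BorelSpace K] [μ.IsAddHaarMeasure] in
/-- **TAIL CANCELLATION** — the coefficients of the shell sum add to zero (`μ(𝔭^a) + Σ_{k<n}(μ(𝔭^{a−k−1}) − μ(𝔭^{a−k})) − μ(𝔭^{a−n}) = 0`, telescoping), hence a summand `g`
common to all shell values drops out: `S(c₀ + g, c + g; n) = S(c₀, c; n)`.  (At N = 3 the common summand is the `t`-TAIL `∫_{‖tδ‖ > τ} ‖tδ‖^{−z} dt` of the shell values, the only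
carrier of their poles on `Re z = ½`.) [cite: JacquetLanglands1970, §3] -/
theorem shellSum_add_const (a : ℤ) (c₀ : ℂ) (c : ℕ → ℂ) (g : ℂ) (n : ℕ) :
    (c₀ + g) * (μ.real (primePowBall K a) : ℂ) +
        (∑ k ∈ Finset.range n, (c k + g) * ((μ.real (primePowBall K (a - ((k : ℤ) + 1))) : ℂ) - (μ.real (primePowBall K (a - (k : ℤ))) : ℂ))) -
        (c n + g) * (μ.real (primePowBall K (a - (n : ℤ))) : ℂ) =
      c₀ * (μ.real (primePowBall K a) : ℂ) +
        (∑ k ∈ Finset.range n, c k * ((μ.real (primePowBall K (a - ((k : ℤ) + 1))) : ℂ) - (μ.real (primePowBall K (a - (k : ℤ))) : ℂ))) -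
        c n * (μ.real (primePowBall K (a - (n : ℤ))) : ℂ) := by
  -- the telescoping sum `Σ_{k<n} (μ_{a−k−1} − μ_{a−k}) = μ_{a−n} − μ_a`
  have htel : ∀ n : ℕ, ∑ k ∈ Finset.range n, ((μ.real (primePowBall K (a - ((k : ℤ) + 1))) : ℂ) - (μ.real (primePowBall K (a - (k : ℤ))) : ℂ)) =
      (μ.real (primePowBall K (a - (n : ℤ))) : ℂ) - (μ.real (primePowBall K a) : ℂ) := by
    intro n
    induction n with
    | zero => rw [Finset.sum_range_zero, Nat.cast_zero, sub_zero, sub_self]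
    | succ n ih => rw [Finset.sum_range_succ, ih, Nat.cast_succ]; ring
  have hsplit : ∑ k ∈ Finset.range n, (c k + g) * ((μ.real (primePowBall K (a - ((k : ℤ) + 1))) : ℂ) - (μ.real (primePowBall K (a - (k : ℤ))) : ℂ)) =
      (∑ k ∈ Finset.range n, c k * ((μ.real (primePowBall K (a - ((k : ℤ) + 1))) : ℂ) - (μ.real (primePowBall K (a - (k : ℤ))) : ℂ))) +
        g * ((μ.real (primePowBall K (a - (n : ℤ))) : ℂ) - (μ.real (primePowBall K a) : ℂ)) := by
    rw [← htel n, Finset.mul_sum, ← Finset.sum_add_distrib]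
    exact Finset.sum_congr rfl fun k _ => by ring
  rw [hsplit]
  ring

omit [BorelSpace K] [μ.IsAddHaarMeasure] in
/-- **The shell-sum bound**: `‖S(c₀, c; n)‖ ≤ ‖c₀‖ μ(𝔭^a) + Σ_{k<n} ‖c_k‖ (μ(𝔭^{a−k−1}) + μ(𝔭^{a−k})) + ‖c_n‖ μ(𝔭^{a−n})`. [folklore] -/
theorem norm_shellSum_le (a : ℤ) (c₀ : ℂ) (c : ℕ → ℂ) (n : ℕ) :
    ‖c₀ * (μ.real (primePowBall K a) : ℂ) +
        (∑ k ∈ Finset.range n, c k * ((μ.real (primePowBall K (a - ((k : ℤ) + 1))) : ℂ) - (μ.real (primePowBall K (a - (k : ℤ))) : ℂ))) -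
        c n * (μ.real (primePowBall K (a - (n : ℤ))) : ℂ)‖ ≤
      ‖c₀‖ * μ.real (primePowBall K a) + (∑ k ∈ Finset.range n, ‖c k‖ * (μ.real (primePowBall K (a - ((k : ℤ) + 1))) + μ.real (primePowBall K (a - (k : ℤ))))) +
        ‖c n‖ * μ.real (primePowBall K (a - (n : ℤ))) := by
  refine (norm_sub_le _ _).trans (add_le_add ((norm_add_le _ _).trans (add_le_add ?_ ((norm_sum_le _ _).trans (Finset.sum_le_sum fun k _ => ?_)))) ?_)
  · rw [norm_mul, Complex.norm_real, Real.norm_of_nonneg measureReal_nonneg]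
  · rw [norm_mul]
    refine mul_le_mul_of_nonneg_left ((norm_sub_le _ _).trans (le_of_eq ?_)) (norm_nonneg _)
    rw [Complex.norm_real, Complex.norm_real, Real.norm_of_nonneg measureReal_nonneg, Real.norm_of_nonneg measureReal_nonneg]
  · rw [norm_mul, Complex.norm_real, Real.norm_of_nonneg measureReal_nonneg]

omit [BorelSpace K] in
/-- **LINEAR IN `n` UNDER THE DECAY LETTER**: if `‖c₀‖·μ(𝔭^a) ≤ B` and `‖c_k‖·μ(𝔭^{a−k−1}) ≤ B` for all `k ≤ n` (at N = 3: `|c_k(z)| ≍ R_k^{1−2Re z}` against `μ(shell_k) ≍ R_k`, so `B`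
is uniform on `Re z ≥ 1`), then `‖S(c₀, c; n)‖ ≤ (2n + 2)·B` — using `μ(𝔭^{a−k}) ≤ μ(𝔭^{a−k−1})` (★ `primePowBall_antitone`).  The divisor-type growth in the conductor-shifted
order `n` of `ξ`. [cite: JacquetLanglands1970, §3] -/
theorem norm_shellSum_le_linear (a : ℤ) (c₀ : ℂ) (c : ℕ → ℂ) (n : ℕ) {B : ℝ} (hB0 : ‖c₀‖ * μ.real (primePowBall K a) ≤ B)
    (hB : ∀ k ≤ n, ‖c k‖ * μ.real (primePowBall K (a - ((k : ℤ) + 1))) ≤ B) :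
    ‖c₀ * (μ.real (primePowBall K a) : ℂ) +
        (∑ k ∈ Finset.range n, c k * ((μ.real (primePowBall K (a - ((k : ℤ) + 1))) : ℂ) - (μ.real (primePowBall K (a - (k : ℤ))) : ℂ))) -
        c n * (μ.real (primePowBall K (a - (n : ℤ))) : ℂ)‖ ≤ (2 * n + 2) * B := by
  have hmono : ∀ k : ℕ, μ.real (primePowBall K (a - (k : ℤ))) ≤ μ.real (primePowBall K (a - ((k : ℤ) + 1))) := fun k =>
    measureReal_mono (primePowBall_antitone (by omega)) (isCompact_primePowBall _).measure_ne_top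
  have hterm : ∀ k ≤ n, ‖c k‖ * (μ.real (primePowBall K (a - ((k : ℤ) + 1))) + μ.real (primePowBall K (a - (k : ℤ)))) ≤ 2 * B := fun k hk => by
    calc ‖c k‖ * (μ.real (primePowBall K (a - ((k : ℤ) + 1))) + μ.real (primePowBall K (a - (k : ℤ))))
        ≤ ‖c k‖ * (μ.real (primePowBall K (a - ((k : ℤ) + 1))) + μ.real (primePowBall K (a - ((k : ℤ) + 1)))) :=
          mul_le_mul_of_nonneg_left (add_le_add le_rfl (hmono k)) (norm_nonneg _)
      _ = 2 * (‖c k‖ * μ.real (primePowBall K (a - ((k : ℤ) + 1)))) := by ring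
      _ ≤ 2 * B := by linarith [hB k hk]
  have hlast : ‖c n‖ * μ.real (primePowBall K (a - (n : ℤ))) ≤ B :=
    (mul_le_mul_of_nonneg_left (hmono n) (norm_nonneg _)).trans (hB n le_rfl)
  refine (norm_shellSum_le μ a c₀ c n).trans ?_
  calc ‖c₀‖ * μ.real (primePowBall K a) + (∑ k ∈ Finset.range n, ‖c k‖ * (μ.real (primePowBall K (a - ((k : ℤ) + 1))) + μ.real (primePowBall K (a - (k : ℤ))))) +
        ‖c n‖ * μ.real (primePowBall K (a - (n : ℤ)))
      ≤ B + (∑ _k ∈ Finset.range n, 2 * B) + B := add_le_add (add_le_add hB0 (Finset.sum_le_sum fun k hk => hterm k (Finset.mem_range.1 hk).le)) hlast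
    _ = (2 * n + 2) * B := by rw [Finset.sum_const, Finset.card_range, nsmul_eq_mul]; ring

omit [ValuativeRel K] [TopologicalSpace K] [IsNonarchimedeanLocalField K] [BorelSpace K] [μ.IsAddHaarMeasure] in
/-- **THE TRIVIAL BOUND** (`|ψ| = 1`): `‖∫_K Ψ(X) ψ(Xξ) dμ‖ ≤ ∫_K ‖Ψ(X)‖ dμ` — for the Whittaker kernel `Ψ_z` this is the UNTWISTED local integral at `σ = Re z`, uniform in the
frequency `ξ` (the W4₃ majorant on compacta of the window). [folklore] -/
theorem norm_integral_mul_addChar_le (Ψ : K → ℂ) (ψ : AddChar K Circle) (ξ : K) :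
    ‖∫ X, Ψ X * ((ψ (X * ξ) : Circle) : ℂ) ∂μ‖ ≤ ∫ X, ‖Ψ X‖ ∂μ := by
  refine (norm_integral_le_integral_norm _).trans (le_of_eq (integral_congr_ae (Eventually.of_forall fun X => ?_)))
  simp only [norm_mul, Circle.norm_coe, mul_one]

/-! ## §4 Parametric holomorphy of the shell sum -/

omit [BorelSpace K] [μ.IsAddHaarMeasure] in
/-- **Holomorphic shell values give a holomorphic shell sum**: if `c₀, c_k : ℂ → ℂ` are holomorphic on `U` then so is `z ↦ S(c₀(z), c(z); n)`. [folklore] -/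
theorem differentiableOn_shellSum {U : Set ℂ} {c₀ : ℂ → ℂ} (hc₀ : DifferentiableOn ℂ c₀ U) {c : ℕ → ℂ → ℂ} (a : ℤ) {n : ℕ} (hc : ∀ k ≤ n, DifferentiableOn ℂ (c k) U) :
    DifferentiableOn ℂ (fun z : ℂ => c₀ z * (μ.real (primePowBall K a) : ℂ) +
        (∑ k ∈ Finset.range n, c k z * ((μ.real (primePowBall K (a - ((k : ℤ) + 1))) : ℂ) - (μ.real (primePowBall K (a - (k : ℤ))) : ℂ))) -
        c n z * (μ.real (primePowBall K (a - (n : ℤ))) : ℂ)) U :=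
  ((hc₀.mul_const _).add (DifferentiableOn.fun_sum fun k hk => (hc k (Finset.mem_range.1 hk).le).mul_const _)).sub ((hc n le_rfl).mul_const _)

omit [BorelSpace K] [μ.IsAddHaarMeasure] in
/-- **Entire shell values give an entire shell sum.** [folklore] -/
theorem differentiable_shellSum {c₀ : ℂ → ℂ} (hc₀ : Differentiable ℂ c₀) {c : ℕ → ℂ → ℂ} (a : ℤ) {n : ℕ} (hc : ∀ k ≤ n, Differentiable ℂ (c k)) :
    Differentiable ℂ (fun z : ℂ => c₀ z * (μ.real (primePowBall K a) : ℂ) +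
        (∑ k ∈ Finset.range n, c k z * ((μ.real (primePowBall K (a - ((k : ℤ) + 1))) : ℂ) - (μ.real (primePowBall K (a - (k : ℤ))) : ℂ))) -
        c n z * (μ.real (primePowBall K (a - (n : ℤ))) : ℂ)) :=
  ((hc₀.mul_const _).add (Differentiable.fun_sum fun k hk => (hc k (Finset.mem_range.1 hk).le).mul_const _)).sub ((hc n le_rfl).mul_const _)

omit [BorelSpace K] [μ.IsAddHaarMeasure] in
/-- **An integral that is a shell sum on a set is holomorphic there**: if `∫_K Ψ_z(X) ψ(Xξ) dμ = S(c₀(z), c(z); n)` for `z ∈ U` with `c₀, c_k` holomorphic on `U`, then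
`z ↦ ∫_K Ψ_z(X) ψ(Xξ) dμ` is holomorphic on `U`. [folklore] -/
theorem differentiableOn_integral_of_eq_shellSum {U : Set ℂ} {Ψ : ℂ → K → ℂ} {ψ : AddChar K Circle} {ξ : K} {a : ℤ} {n : ℕ} {c₀ : ℂ → ℂ}
    (hc₀ : DifferentiableOn ℂ c₀ U) {c : ℕ → ℂ → ℂ} (hc : ∀ k ≤ n, DifferentiableOn ℂ (c k) U)
    (heq : ∀ z ∈ U, ∫ X, Ψ z X * ((ψ (X * ξ) : Circle) : ℂ) ∂μ = c₀ z * (μ.real (primePowBall K a) : ℂ) +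
        (∑ k ∈ Finset.range n, c k z * ((μ.real (primePowBall K (a - ((k : ℤ) + 1))) : ℂ) - (μ.real (primePowBall K (a - (k : ℤ))) : ℂ))) -
        c n z * (μ.real (primePowBall K (a - (n : ℤ))) : ℂ)) :
    DifferentiableOn ℂ (fun z : ℂ => ∫ X, Ψ z X * ((ψ (X * ξ) : Circle) : ℂ) ∂μ) U :=
  (differentiableOn_shellSum μ hc₀ a hc).congr heq



end Summit.HodgeConjecture.HodgeConjecture.Cruxes.H413.K2E1FiniteWhittakerStepSymbolU3

end
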